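import Literature.Computability.QuantumComplexity.ForrelationMemFields
import HarnessLib

/-!
# Explicit `k`-fold Forrelation is in `PromiseBQP`, II: list bricks of the evaluator

Second file of the instantiation (`ForrelationMemFields.lean`). The phase machine reads the circuits
of an instance in the encoding of `Forrelation.lean` (`encodeCodeList`, i.e. the nested-pair list
coding `encList` of `StackLists.lean`; gates `⟨truth table, ⟨wire codes⟩⟩`, wire codes
`0 · bin i` for an input, `1 · bin m` for a gate). This file provides the list-processing layer in the
algebra of `FP` string functions, every brick a fold of `ListFoldBricks.lean` (`Brick.foldFn`, total
semantics through the decoder `Brick.decNil`, growth bounds `Brick.FoldGrowth` valid on **every**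
input):

* `occGF`, `occCF`, `occAllF` — the list of (binary numerals of) **input wires read**, in order of
  occurrence, by a gate, a circuit (arguments, then the output wire), a list of circuits
  (`occW`, `occG`, `occC`, `occAll` their models);
* `dedupF` — **first occurrences by value** (`dedupVals`), giving the list `R` of distinct read
  wires on which the query register is laid out;
* `rankF` — **the position of a numeral in `R`** by value (`rankIdx`), in unary;
* `lenItemsF` (number of items in unary), `revItemsF` (the items reversed).

## References

* S. Arora, B. Barak, *Computational Complexity: A Modern Approach*, CUP 2009, §1.3 (polynomial
  time is closed under composition and bounded loops), §6.1 (descriptions of circuits) [AroraBarak2009].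
* S. Aaronson, A. Ambainis, *Forrelation*, SIAM J. Comput. 47 (2018), §6 (p. 26) [AaronsonAmbainis2018].
-/

noncomputable section

namespace Literature.Computability.QuantumComplexity

open _root_.Computability Polynomial Complexity Complexity.Brick Plumb

namespace ForrMem

/-! ### Generalities on folds with concatenation -/

section FoldGen

/-- The accumulator of a step argument `⟨u, ⟨a, acc⟩⟩`. [folklore] -/
def accF : List Bool → List Bool := sndF ∘ sndF
/-- The item of a step argument `⟨u, ⟨a, acc⟩⟩`. [folklore] -/
def itemF : List Bool → List Bool := fstF ∘ sndF

/-- `accF ∈ FP`. [folklore] -/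
theorem accF_mem_FP : accF ∈ FP := comp_mem_FP sndF_mem_FP sndF_mem_FP
/-- `itemF ∈ FP`. [folklore] -/
theorem itemF_mem_FP : itemF ∈ FP := comp_mem_FP fstF_mem_FP sndF_mem_FP
/-- `accF` on a step argument. [folklore] -/
@[simp] theorem accF_apply (u a acc : List Bool) : accF (boolPair u (boolPair a acc)) = acc := by simp [accF]
/-- `itemF` on a step argument. [folklore] -/
@[simp] theorem itemF_apply (u a acc : List Bool) : itemF (boolPair u (boolPair a acc)) = a := by simp [itemF]

/-- `encList` of a singleton. [folklore] -/
theorem encList_singleton (a : List Bool) : encList [a] = boolPair a [] := by rw [encList_cons, encList_nil]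

/-- `encList` of a concatenation. [folklore] -/
theorem encList_append (l l' : List (List Bool)) : encList (l ++ l') = encList l ++ encList l' := by
  induction l with
  | nil => simp
  | cons a l ih => rw [List.cons_append, encList_cons, encList_cons, ih, RevDesc.boolPair_eq, RevDesc.boolPair_eq]; simp

/-- A left fold appending a function of the items is a `flatMap`. [folklore] -/
theorem foldl_append_eq {α β : Type*} (f : α → List β) : ∀ (l : List α) (init : List β),
    l.foldl (fun acc a => acc ++ f a) init = init ++ l.flatMap f
  | [], init => by simp
  | a :: l, init => by rw [List.foldl_cons, foldl_append_eq f l, List.flatMap_cons, List.append_assoc]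

/-- **Concatenation steps.** A step `v ↦ accF v ++ g v` has growth `c` as soon as
`|g ⟨u, ⟨a, acc⟩⟩| ≤ 4|a| + c(|u| + 1)` on every argument (totally: in terms of `fstF`, `sndF`). [folklore] -/
theorem foldGrowth_append {step g : List Bool → List Bool} {c : ℕ} (hstep : ∀ v, step v = accF v ++ g v)
    (hg : ∀ v, (g v).length ≤ 4 * (fstF (sndF v)).length + c * ((fstF v).length + 1)) :
    FoldGrowth c step := by
  intro v
  rw [hstep, List.length_append]
  have := hg v
  simp only [accF, Function.comp_apply]
  omega

/-- The value of a concatenation fold: the `flatMap` of the models of the pieces. [folklore] -/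
theorem foldFn_append_apply {step g : List Bool → List Bool} (hstep : ∀ v, step v = accF v ++ g v) (w : List Bool)
    (G : List Bool → List Bool) (hG : ∀ a acc, g (boolPair w (boolPair a acc)) = G a) :
    foldFn step (fun _ => []) w = (decNil (sndF w)).flatMap G := by
  rw [foldFn_apply]
  have : (fun acc a => step (boolPair w (boolPair a acc))) = fun acc a => acc ++ G a := by
    funext acc a; rw [hstep, accF_apply, hG]
  rw [this, foldl_append_eq]; rfl

end FoldGen

/-! ### Occurrences of input wires -/

section Occ

/-- The numeral of an input-wire code `0 · bin i` (as a list of one numeral; nothing for a gate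
reference `1 · bin m` or an empty code). [cite: AroraBarak2009, §6.1] -/
def occW (wc : List Bool) : List (List Bool) := if wc.head? = some false then [wc.tail] else []

/-- The test "the item is an input-wire code" (nonempty, head `0`), one-bit. [folklore] -/
def isInputItemF : List Bool → List Bool :=
  andFn (ltLenF ∘ fanoutFn (fun _ => []) (take1Fn ∘ itemF)) (notFn (isSetF (take1Fn ∘ itemF)))

/-- `isInputItemF` is one-bit. [folklore] -/
theorem oneBit_isInputItemF : OneBit isInputItemF := oneBit_andFn (oneBit_ltLenF.comp _) (oneBit_notFn (oneBit_isSetF _))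

/-- `isInputItemF ∈ FP`. [folklore] -/
theorem isInputItemF_mem_FP : isInputItemF ∈ FP :=
  andFn_mem_FP (comp_mem_FP ltLenF_mem_FP (fanoutFn_mem_FP (const_mem_FP _) (comp_mem_FP take1Fn_mem_FP itemF_mem_FP)))
    (notFn_mem_FP (isSetF_mem_FP (comp_mem_FP take1Fn_mem_FP itemF_mem_FP)))

/-- Value of `isInputItemF`. [folklore] -/
theorem isInputItemF_apply (u wc acc : List Bool) :
    isInputItemF (boolPair u (boolPair wc acc)) = [decide (wc.head? = some false)] := by
  have h1 : (ltLenF ∘ fanoutFn (fun _ => []) (take1Fn ∘ itemF)) (boolPair u (boolPair wc acc)) = [decide (0 < (wc.take 1).length)] := by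
    simp [fanoutFn_apply, take1Fn]
  rcases wc with _ | ⟨b, wc⟩
  · rw [isInputItemF, andFn_apply h1 (notFn_apply (isSetF_of_nil (by simp [take1Fn])))]; simp
  · cases b
    · rw [isInputItemF, andFn_apply h1 (notFn_apply (isSetF_of_eq (b := false) (by simp [take1Fn])))]; simp
    · rw [isInputItemF, andFn_apply h1 (notFn_apply (isSetF_of_eq (b := true) (by simp [take1Fn])))]; simp

/-- The contribution of one wire code: `encList (occW wc)`. [folklore] -/
def occWF : List Bool → List Bool := iteFn isInputItemF (fanoutFn (List.tail ∘ itemF) fun _ => []) fun _ => []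

/-- `occWF ∈ FP`. [folklore] -/
theorem occWF_mem_FP : occWF ∈ FP :=
  iteFn_mem_FP isInputItemF_mem_FP (fanoutFn_mem_FP (comp_mem_FP PRelSigma.tail_mem_FP itemF_mem_FP) (const_mem_FP _)) (const_mem_FP _)

/-- Value of `occWF`. [folklore] -/
theorem occWF_apply (u wc acc : List Bool) : occWF (boolPair u (boolPair wc acc)) = encList (occW wc) := by
  rw [occWF, iteFn_apply (isInputItemF_apply u wc acc), occW]
  by_cases h : wc.head? = some false
  · rw [decide_eq_true h, if_pos h]; simp [fanoutFn_apply, encList_singleton]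
  · rw [decide_eq_false h, if_neg h]; simp

/-- Growth of `occWF`: `≤ 2|wc| + 2`. [folklore] -/
theorem length_occWF_le (v : List Bool) : (occWF v).length ≤ 2 * (fstF (sndF v)).length + 2 := by
  rw [occWF, iteFn_of_oneBit oneBit_isInputItemF]
  split_ifs
  · simp only [fanoutFn_apply, length_boolPair, Function.comp_apply, itemF, List.length_nil, List.length_tail]; omega
  · simp

/-- The step of the wire fold. [folklore] -/
def stepW (v : List Bool) : List Bool := accF v ++ occWF v

/-- `stepW ∈ FP`. [folklore] -/
theorem stepW_mem_FP : stepW ∈ FP := append_mem_FP accF_mem_FP occWF_mem_FP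

/-- Growth of `stepW`. [folklore] -/
theorem foldGrowth_stepW : FoldGrowth 2 stepW :=
  foldGrowth_append (fun v => rfl) fun v => by have := length_occWF_le v; omega

/-- The occurrences of input wires in (the argument list of) a gate code `⟨tt, wires⟩`. [cite: AroraBarak2009, §6.1] -/
def occG (gc : List Bool) : List (List Bool) := (decNil (sndF gc)).flatMap occW

/-- **The occurrence brick of a gate**: fold `occWF` over the wires. [folklore] -/
def occGF : List Bool → List Bool := foldFn stepW fun _ => []

/-- `occGF ∈ FP`. [folklore] -/
theorem occGF_mem_FP : occGF ∈ FP := foldFn_mem_FP stepW_mem_FP (const_mem_FP []) foldGrowth_stepW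

/-- Value of `occGF` on every input. [folklore] -/
theorem occGF_apply (gc : List Bool) : occGF gc = encList (occG gc) := by
  rw [occGF, foldFn_append_apply (step := stepW) (g := occWF) (fun v => rfl) gc (fun wc => encList (occW wc))
      (fun a acc => occWF_apply gc a acc), occG]
  induction decNil (sndF gc) with
  | nil => rfl
  | cons a l ih => rw [List.flatMap_cons, List.flatMap_cons, encList_append, ih]

/-- The length of the occurrence code of a gate is at most the length of the gate code. [folklore] -/
theorem length_occGF_le (gc : List Bool) : (occGF gc).length ≤ gc.length := by
  rw [occGF_apply, occG]
  have key : ∀ l : List (List Bool), (encList (l.flatMap occW)).length ≤ (l.map fun a => 2 * a.length).sum := by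
    intro l
    induction l with
    | nil => simp
    | cons a l ih =>
      rw [List.flatMap_cons, encList_append, List.length_append, List.map_cons, List.sum_cons]
      refine Nat.add_le_add ?_ ih
      unfold occW
      split_ifs with h
      · rcases a with _ | ⟨b, a⟩
        · simp at h
        · simp [encList_singleton]; omega
      · simp
  have h1 := key (decNil (sndF gc))
  have h2 := sum_decNil_le (sndF gc)
  have h3 := length_fstF_sndF_le gc
  omega

/-- The occurrences of input wires in a circuit code `⟨gates, output wire⟩`: the arguments of the
gates in order, then the output wire. [cite: AroraBarak2009, §6.1] -/
def occC (cc : List Bool) : List (List Bool) := (decNil (fstF cc)).flatMap occG ++ occW (sndF cc)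

/-- The step of the gate fold. [folklore] -/
def stepG (v : List Bool) : List Bool := accF v ++ occGF (itemF v)

/-- `stepG ∈ FP`. [folklore] -/
theorem stepG_mem_FP : stepG ∈ FP := append_mem_FP accF_mem_FP (comp_mem_FP occGF_mem_FP itemF_mem_FP)

/-- Growth of `stepG`. [folklore] -/
theorem foldGrowth_stepG : FoldGrowth 0 stepG :=
  foldGrowth_append (g := fun v => occGF (itemF v)) (fun v => rfl) fun v => by
    simp only [itemF, Function.comp_apply]; have := length_occGF_le (fstF (sndF v)); omega

/-- The contribution of the output wire: `occWF` on `⟨[], ⟨output wire, []⟩⟩`. [folklore] -/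
def owPartF : List Bool → List Bool := occWF ∘ fanoutFn (fun _ => []) (fanoutFn sndF fun _ => [])

/-- `owPartF ∈ FP`. [folklore] -/
theorem owPartF_mem_FP : owPartF ∈ FP :=
  comp_mem_FP occWF_mem_FP (fanoutFn_mem_FP (const_mem_FP _) (fanoutFn_mem_FP sndF_mem_FP (const_mem_FP _)))

/-- Value of `owPartF`. [folklore] -/
theorem owPartF_apply (cc : List Bool) : owPartF cc = encList (occW (sndF cc)) := by
  simp only [owPartF, Function.comp_apply, fanoutFn_apply, occWF_apply]

/-- **The occurrence brick of a circuit**: fold `occGF` over the gates (context: the output wire,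
list: the gates), then the output wire. [folklore] -/
def occCF : List Bool → List Bool := fun cc => foldFn stepG (fun _ => []) (fanoutFn sndF fstF cc) ++ owPartF cc

/-- `occCF ∈ FP`. [folklore] -/
theorem occCF_mem_FP : occCF ∈ FP := by
  have h1 : foldFn stepG (fun _ => []) ∈ FP := foldFn_mem_FP stepG_mem_FP (const_mem_FP []) foldGrowth_stepG
  have h := append_mem_FP (comp_mem_FP h1 (fanoutFn_mem_FP sndF_mem_FP fstF_mem_FP)) owPartF_mem_FP
  exact h

/-- Value of `occCF` on every input. [folklore] -/
theorem occCF_apply (cc : List Bool) : occCF cc = encList (occC cc) := by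
  rw [occCF, foldFn_append_apply (step := stepG) (g := fun v => occGF (itemF v)) (fun v => rfl) _ (fun gc => encList (occG gc))
      (fun a acc => by simp only [itemF_apply, occGF_apply]),
    fanoutFn_apply, sndF_boolPair, owPartF_apply, occC, encList_append]
  congr 1
  induction decNil (fstF cc) with
  | nil => rfl
  | cons a l ih => rw [List.flatMap_cons, List.flatMap_cons, encList_append, ih]

/-- The length of the occurrence code of a circuit: `≤ 2|cc| + 2`. [folklore] -/
theorem length_occCF_le (cc : List Bool) : (occCF cc).length ≤ 2 * cc.length + 2 := by
  rw [occCF, List.length_append,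
    foldFn_append_apply (step := stepG) (g := fun v => occGF (itemF v)) (fun v => rfl) _ (fun gc => occGF gc) (fun a acc => by simp only [itemF_apply]),
    fanoutFn_apply, sndF_boolPair]
  have h1 : (((decNil (fstF cc)).flatMap fun gc => occGF gc)).length ≤ ((decNil (fstF cc)).map fun a => 2 * a.length).sum := by
    induction decNil (fstF cc) with
    | nil => simp
    | cons a l ih =>
      rw [List.flatMap_cons, List.length_append, List.map_cons, List.sum_cons]
      have := length_occGF_le a; omega
  have h2 := sum_decNil_le (fstF cc)
  have h3 := length_fstF_sndF_le cc
  have h4 : (owPartF cc).length ≤ 2 * (sndF cc).length + 2 := by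
    have := length_occWF_le (fanoutFn (fun _ => []) (fanoutFn sndF fun _ => []) cc)
    simpa [owPartF, fanoutFn_apply] using this
  omega

/-- The occurrences of input wires in a list of circuit codes. [cite: AroraBarak2009, §6.1] -/
def occAll (CL : List Bool) : List (List Bool) := (decNil CL).flatMap occC

/-- The step of the circuit fold. [folklore] -/
def stepC (v : List Bool) : List Bool := accF v ++ occCF (itemF v)

/-- `stepC ∈ FP`. [folklore] -/
theorem stepC_mem_FP : stepC ∈ FP := append_mem_FP accF_mem_FP (comp_mem_FP occCF_mem_FP itemF_mem_FP)

/-- Growth of `stepC`. [folklore] -/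
theorem foldGrowth_stepC : FoldGrowth 2 stepC :=
  foldGrowth_append (g := fun v => occCF (itemF v)) (fun v => rfl) fun v => by
    simp only [itemF, Function.comp_apply]; have := length_occCF_le (fstF (sndF v)); omega

/-- **The occurrence brick of a list of circuits** (context empty, list: the circuits). [folklore] -/
def occAllF : List Bool → List Bool := foldFn stepC (fun _ => []) ∘ fanoutFn (fun _ => []) fun z => z

/-- `occAllF ∈ FP`. [folklore] -/
theorem occAllF_mem_FP : occAllF ∈ FP := by
  have h1 : foldFn stepC (fun _ => []) ∈ FP := foldFn_mem_FP stepC_mem_FP (const_mem_FP []) foldGrowth_stepC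
  exact comp_mem_FP h1 (fanoutFn_mem_FP (const_mem_FP _) (PolyTimeComputable.id _))

/-- Value of `occAllF` on every input. [folklore] -/
theorem occAllF_apply (CL : List Bool) : occAllF CL = encList (occAll CL) := by
  rw [occAllF, Function.comp_apply,
    foldFn_append_apply (step := stepC) (g := fun v => occCF (itemF v)) (fun v => rfl) _ (fun cc => encList (occC cc))
      (fun a acc => by simp only [itemF_apply, occCF_apply]),
    fanoutFn_apply, sndF_boolPair, occAll]
  induction decNil CL with
  | nil => rfl
  | cons a l ih => rw [List.flatMap_cons, List.flatMap_cons, encList_append, ih]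

end Occ

/-! ### First occurrences by value, rank by value, number of items, reversal -/

section Dedup

/-- **First occurrences by value** (the model of `dedupF`): keep an item unless an item of the same
binary value has been kept. [folklore] -/
def dedupVals (l : List (List Bool)) : List (List Bool) :=
  l.foldl (fun acc a => acc ++ if ∃ b ∈ acc, bitsToNat a = bitsToNat b then [] else [a]) []

/-- The membership-by-value test of the item in the accumulator, one-bit. [folklore] -/
def memValF : List Bool → List Bool := anyFn eqValFn ∘ fanoutFn itemF accF

/-- `memValF` is one-bit. [folklore] -/
theorem oneBit_memValF : OneBit memValF := (oneBit_anyFn oneBit_eqValFn).comp _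

/-- `memValF ∈ FP`. [folklore] -/
theorem memValF_mem_FP : memValF ∈ FP :=
  comp_mem_FP (anyFn_mem_FP eqValFn_mem_FP oneBit_eqValFn) (fanoutFn_mem_FP itemF_mem_FP accF_mem_FP)

/-- Value of `memValF`. [folklore] -/
theorem memValF_apply (u a acc : List Bool) :
    memValF (boolPair u (boolPair a acc)) = [decide (∃ b ∈ decNil acc, bitsToNat a = bitsToNat b)] := by
  rw [memValF, Function.comp_apply, fanoutFn_apply, itemF_apply, accF_apply, anyFn_boolPair oneBit_eqValFn]
  simp

/-- The new part of the accumulator: the item as a one-item code unless already present by value. [folklore] -/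
def newItemF : List Bool → List Bool := iteFn memValF (fun _ => []) (fanoutFn itemF fun _ => [])

/-- `newItemF ∈ FP`. [folklore] -/
theorem newItemF_mem_FP : newItemF ∈ FP :=
  iteFn_mem_FP memValF_mem_FP (const_mem_FP _) (fanoutFn_mem_FP itemF_mem_FP (const_mem_FP _))

/-- Value of `newItemF`. [folklore] -/
theorem newItemF_apply (u a acc : List Bool) :
    newItemF (boolPair u (boolPair a acc)) = if ∃ b ∈ decNil acc, bitsToNat a = bitsToNat b then [] else boolPair a [] := by
  rw [newItemF, iteFn_apply (memValF_apply u a acc)]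
  by_cases h : ∃ b ∈ decNil acc, bitsToNat a = bitsToNat b
  · rw [decide_eq_true h, if_pos rfl, if_pos h]
  · rw [decide_eq_false h, if_neg Bool.false_ne_true, if_neg h, fanoutFn_apply, itemF_apply]

/-- The step of the deduplication fold. [folklore] -/
def stepD (v : List Bool) : List Bool := accF v ++ newItemF v

/-- `stepD ∈ FP`. [folklore] -/
theorem stepD_mem_FP : stepD ∈ FP := append_mem_FP accF_mem_FP newItemF_mem_FP

/-- Growth of `stepD`. [folklore] -/
theorem foldGrowth_stepD : FoldGrowth 2 stepD :=
  foldGrowth_append (fun v => rfl) fun v => by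
    rw [newItemF, iteFn_of_oneBit oneBit_memValF]
    split_ifs
    · simp
    · simp only [fanoutFn_apply, length_boolPair, itemF, Function.comp_apply, List.length_nil]; omega

/-- **The deduplication brick.** [folklore] -/
def dedupF : List Bool → List Bool := foldFn stepD (fun _ => []) ∘ fanoutFn (fun _ => []) fun z => z

/-- `dedupF ∈ FP`. [folklore] -/
theorem dedupF_mem_FP : dedupF ∈ FP := by
  have h1 : foldFn stepD (fun _ => []) ∈ FP := foldFn_mem_FP stepD_mem_FP (const_mem_FP []) foldGrowth_stepD
  exact comp_mem_FP h1 (fanoutFn_mem_FP (const_mem_FP _) (PolyTimeComputable.id _))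

/-- The deduplication fold keeps a code of its model. [folklore] -/
theorem foldl_stepD (u : List Bool) : ∀ (l : List (List Bool)) (kept : List (List Bool)),
    l.foldl (fun acc a => stepD (boolPair u (boolPair a acc))) (encList kept) =
      encList (l.foldl (fun acc a => acc ++ if ∃ b ∈ acc, bitsToNat a = bitsToNat b then [] else [a]) kept)
  | [], kept => rfl
  | a :: l, kept => by
    rw [List.foldl_cons, List.foldl_cons, stepD, accF_apply, newItemF_apply, decNil_encList]
    have e : (encList kept ++ if ∃ b ∈ kept, bitsToNat a = bitsToNat b then [] else boolPair a []) =
        encList (kept ++ if ∃ b ∈ kept, bitsToNat a = bitsToNat b then [] else [a]) := by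
      split_ifs <;> simp [encList_append, encList_singleton]
    rw [e, foldl_stepD u l]

/-- **Value of `dedupF` on every input.** [folklore] -/
theorem dedupF_apply (O : List Bool) : dedupF O = encList (dedupVals (decNil O)) := by
  rw [dedupF, Function.comp_apply, foldFn_apply, fanoutFn_apply, sndF_boolPair, dedupVals, ← foldl_stepD, encList_nil]

/-- `dedupVals`, one more item. [folklore] -/
theorem dedupVals_append_singleton (l : List (List Bool)) (a : List Bool) :
    dedupVals (l ++ [a]) = dedupVals l ++ if ∃ b ∈ dedupVals l, bitsToNat a = bitsToNat b then [] else [a] := by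
  simp [dedupVals, List.foldl_append]

/-- The values of `dedupVals l` are pairwise distinct. [folklore] -/
theorem nodup_map_dedupVals (l : List (List Bool)) : ((dedupVals l).map bitsToNat).Nodup := by
  induction l using List.reverseRecOn with
  | nil => simp [dedupVals]
  | append_singleton l a ih =>
    rw [dedupVals_append_singleton]
    split_ifs with h
    · simpa using ih
    · rw [List.map_append, List.nodup_append]
      refine ⟨ih, by simp, ?_⟩
      intro v hv w hw
      simp only [List.map_cons, List.map_nil, List.mem_singleton] at hw
      subst hw
      obtain ⟨b, hb, rfl⟩ := List.mem_map.1 hv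
      exact fun e => h ⟨b, hb, e.symm⟩

/-- Every value of `l` is a value of `dedupVals l`, and conversely. [folklore] -/
theorem mem_map_dedupVals_iff (l : List (List Bool)) (v : ℕ) : v ∈ (dedupVals l).map bitsToNat ↔ v ∈ l.map bitsToNat := by
  induction l using List.reverseRecOn with
  | nil => simp [dedupVals]
  | append_singleton l a ih =>
    rw [dedupVals_append_singleton, List.map_append, List.map_append, List.mem_append, List.mem_append, ih]
    split_ifs with h
    · simp only [List.map_nil, List.not_mem_nil, or_false, List.map_cons, List.mem_singleton]
      constructor
      · exact Or.inl
      · rintro (h' | rfl)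
        · exact h'
        · obtain ⟨b, hb, e⟩ := h
          exact ih.1 (List.mem_map.2 ⟨b, hb, e.symm⟩)
    · simp

end Dedup

section Rank

/-- **The rank of a numeral in a list, by value** (the model of `rankF`): the position of the first
item of the same binary value, or the length of the list. [folklore] -/
def rankIdx (qn : List Bool) (R : List (List Bool)) : ℕ := R.findIdx fun a => bitsToNat a == bitsToNat qn

/-- The step of the rank fold: accumulator `⟨flag, 1^pos⟩`; once the flag is set nothing changes;
an item of the query's value sets the flag; otherwise the position advances. [folklore] -/
def stepR : List Bool → List Bool :=
  iteFn (isSetF (fstF ∘ accF)) accF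
    (iteFn (eqValFn ∘ fanoutFn itemF (fstF ∘ fstF)) (fanoutFn (fun _ => [true]) (sndF ∘ accF))
      (fanoutFn (fun _ => []) fun v => sndF (accF v) ++ [true]))

/-- `stepR ∈ FP`. [folklore] -/
theorem stepR_mem_FP : stepR ∈ FP :=
  iteFn_mem_FP (isSetF_mem_FP (comp_mem_FP fstF_mem_FP accF_mem_FP)) accF_mem_FP
    (iteFn_mem_FP (comp_mem_FP eqValFn_mem_FP (fanoutFn_mem_FP itemF_mem_FP (comp_mem_FP fstF_mem_FP fstF_mem_FP)))
      (fanoutFn_mem_FP (const_mem_FP _) (comp_mem_FP sndF_mem_FP accF_mem_FP))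
      (fanoutFn_mem_FP (const_mem_FP _) (append_mem_FP (comp_mem_FP sndF_mem_FP accF_mem_FP) (const_mem_FP _))))

/-- Value of `stepR` before the match. [folklore] -/
theorem stepR_apply_false (qn R a pos : List Bool) :
    stepR (boolPair (boolPair qn R) (boolPair a (boolPair [] pos))) =
      if bitsToNat a = bitsToNat qn then boolPair [true] pos else boolPair [] (pos ++ [true]) := by
  have hacc : accF (boolPair (boolPair qn R) (boolPair a (boolPair [] pos))) = boolPair [] pos := accF_apply _ _ _
  have h1 : isSetF (fstF ∘ accF) (boolPair (boolPair qn R) (boolPair a (boolPair [] pos))) = [false] :=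
    isSetF_of_nil (by rw [Function.comp_apply, hacc]; simp)
  have h2 : (eqValFn ∘ fanoutFn itemF (fstF ∘ fstF)) (boolPair (boolPair qn R) (boolPair a (boolPair [] pos))) =
      [decide (bitsToNat a = bitsToNat qn)] := by
    simp [fanoutFn_apply]
  rw [stepR, iteFn_apply_false h1, iteFn_apply h2]
  by_cases hv : bitsToNat a = bitsToNat qn
  · rw [decide_eq_true hv, if_pos rfl, if_pos hv, fanoutFn_apply, Function.comp_apply, hacc, sndF_boolPair]
  · rw [decide_eq_false hv, if_neg Bool.false_ne_true, if_neg hv, fanoutFn_apply, hacc, sndF_boolPair]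

/-- Value of `stepR` after the match. [folklore] -/
theorem stepR_apply_true (qn R a pos : List Bool) :
    stepR (boolPair (boolPair qn R) (boolPair a (boolPair [true] pos))) = boolPair [true] pos := by
  have hacc : accF (boolPair (boolPair qn R) (boolPair a (boolPair [true] pos))) = boolPair [true] pos := accF_apply _ _ _
  have h1 : isSetF (fstF ∘ accF) (boolPair (boolPair qn R) (boolPair a (boolPair [true] pos))) = [true] :=
    isSetF_of_eq (by rw [Function.comp_apply, hacc]; simp)
  rw [stepR, iteFn_apply_true h1, hacc]

/-- Growth of `stepR`: at most `4` beyond the accumulator. [folklore] -/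
theorem foldGrowth_stepR : FoldGrowth 4 stepR := by
  intro v
  rw [stepR, iteFn_of_oneBit (oneBit_isSetF _)]
  split_ifs
  · simp only [accF, Function.comp_apply]; omega
  · rw [iteFn_of_oneBit (oneBit_eqValFn.comp _)]
    have h := length_fstF_sndF_le (sndF (sndF v))
    split_ifs
    · simp only [fanoutFn_apply, length_boolPair, accF, Function.comp_apply, List.length_singleton]; omega
    · simp only [fanoutFn_apply, length_boolPair, accF, Function.comp_apply, List.length_nil, List.length_append, List.length_singleton]
      omega

/-- **The rank brick** on `⟨query, list⟩`: the final accumulator `⟨flag, 1^rank⟩`. [folklore] -/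
def rankF : List Bool → List Bool := foldFn stepR fun _ => boolPair [] []

/-- `rankF ∈ FP`. [folklore] -/
theorem rankF_mem_FP : rankF ∈ FP := foldFn_mem_FP stepR_mem_FP (const_mem_FP _) foldGrowth_stepR

/-- The rank fold after the match: nothing changes. [folklore] -/
theorem foldl_stepR_true (qn R : List Bool) (pos : List Bool) : ∀ l : List (List Bool),
    l.foldl (fun acc a => stepR (boolPair (boolPair qn R) (boolPair a acc))) (boolPair [true] pos) = boolPair [true] pos
  | [] => rfl
  | a :: l => by rw [List.foldl_cons, stepR_apply_true, foldl_stepR_true qn R pos l]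

/-- The rank fold before the match: the position advances to the first match. [folklore] -/
theorem foldl_stepR_false (qn R : List Bool) : ∀ (l : List (List Bool)) (pos : ℕ),
    sndF (l.foldl (fun acc a => stepR (boolPair (boolPair qn R) (boolPair a acc))) (boolPair [] (ones pos))) =
      ones (pos + l.findIdx fun a => bitsToNat a == bitsToNat qn)
  | [], pos => by simp
  | a :: l, pos => by
    rw [List.foldl_cons, stepR_apply_false, List.findIdx_cons]
    by_cases hv : bitsToNat a = bitsToNat qn
    · rw [if_pos hv, foldl_stepR_true, sndF_boolPair]
      simp [hv]
    · rw [if_neg hv, show ones pos ++ [true] = ones (pos + 1) by simp [ones, List.replicate_succ'], foldl_stepR_false qn R l (pos + 1)]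
      have hb : (bitsToNat a == bitsToNat qn) = false := by simpa using hv
      simp only [hb, cond_false]
      congr 1; omega

/-- **Value of `rankF` on every input**: `⟨flag, 1^{rankIdx}⟩`. [folklore] -/
theorem rankF_apply (qn R : List Bool) :
    sndF (rankF (boolPair qn R)) = ones (rankIdx qn (decNil R)) := by
  rw [rankF, foldFn_apply, sndF_boolPair]
  have := foldl_stepR_false qn R (decNil R) 0
  rw [Nat.zero_add] at this
  exact this

/-- The rank of a value that occurs is the index of its first occurrence. [folklore] -/
theorem rankIdx_lt_length {qn : List Bool} {l : List (List Bool)} (h : bitsToNat qn ∈ l.map bitsToNat) :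
    rankIdx qn l < l.length := by
  rw [rankIdx, List.findIdx_lt_length]
  obtain ⟨a, ha, e⟩ := List.mem_map.1 h
  exact ⟨a, ha, by simp [e]⟩

/-- The item at the rank has the query's value. [folklore] -/
theorem bitsToNat_getElem_rankIdx {qn : List Bool} {l : List (List Bool)} (h : rankIdx qn l < l.length) :
    bitsToNat (l[rankIdx qn l]) = bitsToNat qn := by
  have := List.findIdx_getElem (w := h)
  simp only [beq_iff_eq] at this
  exact this

end Rank

section LenRev

/-- The step counting items in unary. [folklore] -/
def stepL (v : List Bool) : List Bool := accF v ++ [true]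

/-- **The number of items, in unary.** [folklore] -/
def lenItemsF : List Bool → List Bool := foldFn stepL (fun _ => []) ∘ fanoutFn (fun _ => []) fun z => z

/-- `lenItemsF ∈ FP`. [folklore] -/
theorem lenItemsF_mem_FP : lenItemsF ∈ FP := by
  have h1 : foldFn stepL (fun _ => []) ∈ FP :=
    foldFn_mem_FP (append_mem_FP accF_mem_FP (const_mem_FP _)) (const_mem_FP [])
      (foldGrowth_append (c := 1) (g := fun _ => [true]) (fun v => rfl) fun v => by simp only [List.length_singleton]; omega)
  exact comp_mem_FP h1 (fanoutFn_mem_FP (const_mem_FP _) (PolyTimeComputable.id _))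

/-- **Value of `lenItemsF` on every input.** [folklore] -/
theorem lenItemsF_apply (L : List Bool) : lenItemsF L = ones (decNil L).length := by
  rw [lenItemsF, Function.comp_apply,
    foldFn_append_apply (step := stepL) (g := fun _ => [true]) (fun v => rfl) _ (fun _ => [true]) (fun a acc => rfl),
    fanoutFn_apply, sndF_boolPair]
  induction decNil L with
  | nil => rfl
  | cons a l ih => rw [List.flatMap_cons, ih]; simp [ones, List.replicate_succ]

/-- The step prepending the item as a one-item code. [folklore] -/
def stepV (v : List Bool) : List Bool := fanoutFn itemF (fun _ => []) v ++ accF v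

/-- `stepV ∈ FP`. [folklore] -/
theorem stepV_mem_FP : stepV ∈ FP :=
  append_mem_FP (fanoutFn_mem_FP itemF_mem_FP (const_mem_FP _)) accF_mem_FP

/-- Growth of `stepV`. [folklore] -/
theorem foldGrowth_stepV : FoldGrowth 2 stepV := by
  intro v
  simp only [stepV, fanoutFn_apply, List.length_append, length_boolPair, itemF, accF, Function.comp_apply, List.length_nil]
  omega

/-- **The items reversed** (as a code). [folklore] -/
def revItemsF : List Bool → List Bool := foldFn stepV (fun _ => []) ∘ fanoutFn (fun _ => []) fun z => z

/-- `revItemsF ∈ FP`. [folklore] -/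
theorem revItemsF_mem_FP : revItemsF ∈ FP := by
  have h1 : foldFn stepV (fun _ => []) ∈ FP := foldFn_mem_FP stepV_mem_FP (const_mem_FP []) foldGrowth_stepV
  exact comp_mem_FP h1 (fanoutFn_mem_FP (const_mem_FP _) (PolyTimeComputable.id _))

/-- **Value of `revItemsF` on every input.** [folklore] -/
theorem revItemsF_apply (L : List Bool) : revItemsF L = encList (decNil L).reverse := by
  rw [revItemsF, Function.comp_apply, foldFn_apply, fanoutFn_apply, sndF_boolPair]
  have key : ∀ (l : List (List Bool)) (acc : List (List Bool)),
      l.foldl (fun acc a => stepV (boolPair (boolPair [] L) (boolPair a acc))) (encList acc) = encList (l.reverse ++ acc) := by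
    intro l
    induction l with
    | nil => intro acc; simp
    | cons a l ih =>
      intro acc
      rw [List.foldl_cons, stepV, fanoutFn_apply, itemF_apply, accF_apply, ← encList_singleton, ← encList_append, ih,
        List.reverse_cons, List.append_assoc, List.singleton_append]
  have := key (decNil L) []
  rw [encList_nil, List.append_nil] at this
  exact this

end LenRev

end ForrMem

end Literature.Computability.QuantumComplexity
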